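import Mathlib
import Literature.Analysis.Calculus.IntervalCauchySchwarz
import HarnessLib

/-!
# Cutting off finite-energy data at large scales costs little energy

Analysis/Calculus support file (everything proved).
* `exists_smooth_cutoff`: a smooth `χ : ℝ → [0,1]`, `χ = 1` on `(−∞,1]`, `χ = 0` on `[2,∞)`, with
  bounded derivative.
* `sq_le_of_sq_deriv` : for `h ∈ C¹` and `k ≤ x`, `h(x)² ≤ 2h(k)² + 2(x−k)∫_k^x h'²`.
* `energy_tail_cutoff_small`: if `h ∈ C¹`, `g`, `W ≥ 0` are continuous and `h'², W h², g²` are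
  integrable on `(1,∞)`, then for every `ε > 0` and all large `R` the "far part"
  `((1 − χ(·/R)) h, (1 − χ(·/R)) g)` of the data has energy
  `∫_{x>1} ((1−χ_R)h)'² + W((1−χ_R)h)² + ((1−χ_R)g)² ≤ ε`.
  (The only delicate point is `R⁻²∫_R^{2R} h² → 0`, which follows from `h' ∈ L²` alone through
  `h(R)²/R → 0`.)
This is the density step (compactly supported data are energy-dense) of the far-side channel
estimate of route PhotonSphereChannels (`FixedModeChannels`, stmt-FinalStateConjecture-10048).
Folklore.
-/

noncomputable section

namespace Literature.Analysis.Calculus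

open Set Filter Topology MeasureTheory intervalIntegral

/-- **A smooth cutoff** equal to `1` on `(−∞,1]` and to `0` on `[2,∞)`, with values in `[0,1]` and
bounded derivative. [folklore] -/
theorem exists_smooth_cutoff :
    ∃ χ : ℝ → ℝ, ContDiff ℝ (⊤ : ℕ∞) χ ∧ (∀ x, x ≤ 1 → χ x = 1) ∧ (∀ x, 2 ≤ x → χ x = 0) ∧
      (∀ x, 0 ≤ χ x ∧ χ x ≤ 1) ∧ ∃ C : ℝ, 0 ≤ C ∧ ∀ x, |deriv χ x| ≤ C := by
  set χ : ℝ → ℝ := fun x => 1 - Real.smoothTransition (x - 1) with hχ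
  have hC : ContDiff ℝ (⊤ : ℕ∞) χ :=
    contDiff_const.sub (Real.smoothTransition.contDiff.comp (contDiff_id.sub contDiff_const))
  refine ⟨χ, hC, fun x hx => ?_, fun x hx => ?_, fun x => ?_, ?_⟩
  · simp only [hχ, Real.smoothTransition.zero_of_nonpos (by linarith : x - 1 ≤ 0), sub_zero]
  · simp only [hχ, Real.smoothTransition.one_of_one_le (by linarith : 1 ≤ x - 1), sub_self]
  · exact ⟨by simp only [hχ]; linarith [Real.smoothTransition.le_one (x - 1)],
      by simp only [hχ]; linarith [Real.smoothTransition.nonneg (x - 1)]⟩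
  · -- the derivative is continuous and vanishes outside `[1, 2]`
    have hdc : Continuous (deriv χ) := hC.continuous_deriv (by simp)
    obtain ⟨C, hCb⟩ :=
      isCompact_Icc.exists_bound_of_continuousOn (s := Icc (1 : ℝ) 2) hdc.continuousOn
    refine ⟨max C 0, le_max_right _ _, fun x => ?_⟩
    by_cases hx : x ∈ Icc (1 : ℝ) 2
    · exact (Real.norm_eq_abs _ ▸ hCb x hx).trans (le_max_left _ _)
    · -- locally constant there
      have hx' : x < 1 ∨ 2 < x := by
        rcases not_and_or.1 hx with h | h
        · exact Or.inl (lt_of_not_ge h)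
        · exact Or.inr (lt_of_not_ge h)
      have hd0 : deriv χ x = 0 := by
        rcases hx' with h | h
        · have hev : χ =ᶠ[𝓝 x] fun _ => 1 :=
            Filter.mem_of_superset (Iio_mem_nhds h) fun y hy => by
              have hy' : y < 1 := hy
              show 1 - Real.smoothTransition (y - 1) = 1
              rw [Real.smoothTransition.zero_of_nonpos (by linarith), sub_zero]
          rw [hev.deriv_eq, deriv_const]
        · have hev : χ =ᶠ[𝓝 x] fun _ => 0 :=
            Filter.mem_of_superset (Ioi_mem_nhds h) fun y hy => by
              have hy' : 2 < y := hy
              show 1 - Real.smoothTransition (y - 1) = 0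
              rw [Real.smoothTransition.one_of_one_le (by linarith), sub_self]
          rw [hev.deriv_eq, deriv_const]
      rw [hd0, abs_zero]; exact le_max_right _ _

/-- `h(x)² ≤ 2 h(k)² + 2 (x − k) ∫_k^x h'²` for `h ∈ C¹`, `k ≤ x`. [folklore] -/
theorem sq_le_of_sq_deriv {h : ℝ → ℝ} (hh : ContDiff ℝ 1 h) {k x : ℝ} (hkx : k ≤ x) :
    h x ^ 2 ≤ 2 * h k ^ 2 + 2 * (x - k) * ∫ y in k..x, deriv h y ^ 2 := by
  have hd : ∀ y, HasDerivAt h (deriv h y) y := fun y =>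
    (hh.differentiable (by norm_num) y).hasDerivAt
  have hdc : Continuous (deriv h) := hh.continuous_deriv le_rfl
  have hftc : (∫ y in k..x, deriv h y) = h x - h k :=
    integral_eq_sub_of_hasDerivAt (fun y _ => hd y) (hdc.intervalIntegrable _ _)
  have hcs := abs_intervalIntegral_mul_le_sqrt (f := fun _ => (1 : ℝ)) (g := deriv h)
    continuous_const hdc hkx
  simp only [one_mul, one_pow, intervalIntegral.integral_const, smul_eq_mul, mul_one] at hcs
  have hI0 : 0 ≤ ∫ y in k..x, deriv h y ^ 2 := integral_nonneg hkx fun y _ => sq_nonneg _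
  have hxk : 0 ≤ x - k := by linarith
  have hsq : (h x - h k) ^ 2 ≤ (x - k) * ∫ y in k..x, deriv h y ^ 2 := by
    rw [← hftc]
    calc (∫ y in k..x, deriv h y) ^ 2 = |∫ y in k..x, deriv h y| ^ 2 := (sq_abs _).symm
      _ ≤ (Real.sqrt (x - k) * Real.sqrt (∫ y in k..x, deriv h y ^ 2)) ^ 2 :=
          pow_le_pow_left₀ (abs_nonneg _) hcs 2
      _ = (x - k) * ∫ y in k..x, deriv h y ^ 2 := by
          rw [mul_pow, Real.sq_sqrt hxk, Real.sq_sqrt hI0]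
  nlinarith [hsq, sq_nonneg (h x - 2 * h k), sq_nonneg (h k)]

/-- Pointwise algebra of the cut-off energy density: with `|a| ≤ c`, `0 ≤ θ ≤ 1`, `0 ≤ W`,
`(a h + θ h')² + W (θ h)² + (θ g)² ≤ (2h'² + W h² + g²) + 2 c² h²`. [folklore] -/
theorem cutoff_density_le {a c θ W h h' g : ℝ} (ha : |a| ≤ c) (hθ0 : 0 ≤ θ) (hθ1 : θ ≤ 1)
    (hW : 0 ≤ W) :
    (a * h + θ * h') ^ 2 + W * (θ * h) ^ 2 + (θ * g) ^ 2
      ≤ (2 * h' ^ 2 + W * h ^ 2 + g ^ 2) + 2 * c ^ 2 * h ^ 2 := by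
  have ha2 : a ^ 2 ≤ c ^ 2 := by rw [← sq_abs]; exact pow_le_pow_left₀ (abs_nonneg _) ha 2
  have hθ2 : θ ^ 2 ≤ 1 := by nlinarith
  have e1 : (a * h + θ * h') ^ 2 ≤ 2 * c ^ 2 * h ^ 2 + 2 * h' ^ 2 := by
    nlinarith [sq_nonneg (a * h - θ * h'), mul_le_mul_of_nonneg_right ha2 (sq_nonneg h),
      mul_le_mul_of_nonneg_right hθ2 (sq_nonneg h')]
  have e2 : W * (θ * h) ^ 2 ≤ W * h ^ 2 := by
    rw [mul_pow]
    exact mul_le_mul_of_nonneg_left (by nlinarith [sq_nonneg h]) hW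
  have e3 : (θ * g) ^ 2 ≤ g ^ 2 := by rw [mul_pow]; nlinarith [sq_nonneg g]
  linarith

/-- Tails of an integrable function on a half-line tend to zero: `∫_{x>R} f → 0`. [folklore] -/
theorem tendsto_setIntegral_Ioi_tail {f : ℝ → ℝ} {a : ℝ} (hf : IntegrableOn f (Ioi a)) :
    Tendsto (fun R => ∫ x in Ioi R, f x) atTop (𝓝 0) := by
  have hlim := intervalIntegral_tendsto_integral_Ioi a hf tendsto_id
  have hsplit : ∀ R, a ≤ R → (∫ x in Ioi R, f x) = (∫ x in Ioi a, f x) - ∫ x in a..R, f x := by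
    intro R hR
    rw [← Ioc_union_Ioi_eq_Ioi hR, setIntegral_union (Ioc_disjoint_Ioi le_rfl) measurableSet_Ioi
      (hf.mono_set Ioc_subset_Ioi_self) (hf.mono_set (Ioi_subset_Ioi hR)),
      intervalIntegral.integral_of_le hR]
    ring
  have h2 : Tendsto (fun R => (∫ x in Ioi a, f x) - ∫ x in a..R, f x) atTop (𝓝 0) := by
    have := (tendsto_const_nhds (x := ∫ x in Ioi a, f x)).sub hlim
    simpa using this
  refine h2.congr' ?_
  filter_upwards [Filter.eventually_ge_atTop a] with R hR
  exact (hsplit R hR).symm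

/-- **Cut-off data have small far energy.** See the module docstring. [folklore] -/
theorem energy_tail_cutoff_small {h g W χ : ℝ → ℝ} (hh : ContDiff ℝ 1 h) (hg : Continuous g)
    (hW : Continuous W) (hW0 : ∀ x, 0 ≤ W x)
    (hE1 : IntegrableOn (fun x => deriv h x ^ 2) (Ioi 1))
    (hE2 : IntegrableOn (fun x => W x * h x ^ 2) (Ioi 1))
    (hE3 : IntegrableOn (fun x => g x ^ 2) (Ioi 1))
    (hχC : ContDiff ℝ (⊤ : ℕ∞) χ) (hχ1 : ∀ x, x ≤ 1 → χ x = 1) (hχ2 : ∀ x, 2 ≤ x → χ x = 0)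
    (hχ01 : ∀ x, 0 ≤ χ x ∧ χ x ≤ 1) {C : ℝ} (hC : ∀ x, |deriv χ x| ≤ C)
    {ε : ℝ} (hε : 0 < ε) :
    ∃ R₀ : ℝ, 1 ≤ R₀ ∧ ∀ R, R₀ ≤ R →
      IntegrableOn (fun x => deriv (fun y => (1 - χ (y / R)) * h y) x ^ 2
          + W x * ((1 - χ (x / R)) * h x) ^ 2 + ((1 - χ (x / R)) * g x) ^ 2) (Ioi 1) ∧
      ∫ x in Ioi 1, (deriv (fun y => (1 - χ (y / R)) * h y) x ^ 2
          + W x * ((1 - χ (x / R)) * h x) ^ 2 + ((1 - χ (x / R)) * g x) ^ 2) ≤ ε := by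
  -- notation and basic facts
  have hd : ∀ y, HasDerivAt h (deriv h y) y := fun y =>
    (hh.differentiable (by norm_num) y).hasDerivAt
  have hdc : Continuous (deriv h) := hh.continuous_deriv le_rfl
  have hhc : Continuous h := hh.continuous
  have hχd : ∀ y, HasDerivAt χ (deriv χ y) y := fun y =>
    (hχC.differentiable (by simp) y).hasDerivAt
  set f : ℝ → ℝ := fun x => 2 * deriv h x ^ 2 + W x * h x ^ 2 + g x ^ 2 with hf
  have hfi : IntegrableOn f (Ioi 1) := ((hE1.const_mul 2).add hE2).add hE3
  have hf0 : ∀ x, 0 ≤ f x := fun x => by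
    have := hW0 x; simp only [hf]; positivity
  -- tails
  set T : ℝ → ℝ := fun k => ∫ x in Ioi k, deriv h x ^ 2 with hT
  set τ : ℝ → ℝ := fun R => ∫ x in Ioi R, f x with hτ
  have hT0 : ∀ k, 0 ≤ T k := fun k => setIntegral_nonneg measurableSet_Ioi fun x _ => sq_nonneg _
  have hTlim : Tendsto T atTop (𝓝 0) := tendsto_setIntegral_Ioi_tail hE1
  have hτlim : Tendsto τ atTop (𝓝 0) := tendsto_setIntegral_Ioi_tail hfi
  have hTmono : ∀ k k', 1 ≤ k → k ≤ k' → T k' ≤ T k := fun k k' hk hkk' =>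
    setIntegral_mono_set (hE1.mono_set (Ioi_subset_Ioi hk))
      (ae_of_all _ fun x => sq_nonneg _) (ae_of_all _ (Ioi_subset_Ioi hkk'))
  have hTint : ∀ k x, 1 ≤ k → k ≤ x → (∫ y in k..x, deriv h y ^ 2) ≤ T k := by
    intro k x hk hkx
    rw [intervalIntegral.integral_of_le hkx]
    exact setIntegral_mono_set (hE1.mono_set (Ioi_subset_Ioi hk))
      (ae_of_all _ fun x => sq_nonneg _) (ae_of_all _ Ioc_subset_Ioi_self)
  -- pointwise growth bound `h(x)² ≤ 2h(k)² + 2(x-k) T(k)`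
  have hgrow : ∀ k x, 1 ≤ k → k ≤ x → h x ^ 2 ≤ 2 * h k ^ 2 + 2 * (x - k) * T k := by
    intro k x hk hkx
    have h1 := sq_le_of_sq_deriv hh hkx
    have h2 := hTint k x hk hkx
    nlinarith [h2, (by linarith : (0 : ℝ) ≤ x - k)]
  -- choose `k`, then `R₀`
  obtain ⟨k, hk1, hk⟩ : ∃ k, 1 ≤ k ∧ 8 * C ^ 2 * T k ≤ ε / 4 := by
    have h := (hTlim.const_mul (8 * C ^ 2))
    rw [mul_zero] at h
    obtain ⟨k, hk⟩ := (h.eventually (ge_mem_nhds (by positivity : (0:ℝ) < ε / 4))).and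
      (Filter.eventually_ge_atTop 1) |>.exists
    exact ⟨k, hk.2, hk.1⟩
  obtain ⟨R₁, hR₁⟩ : ∃ R₁, ∀ R, R₁ ≤ R → τ R ≤ ε / 8 := by
    obtain ⟨R₁, h⟩ := (hτlim.eventually (ge_mem_nhds (by positivity : (0:ℝ) < ε / 8)))
      |>.exists_forall_of_atTop
    exact ⟨R₁, h⟩
  obtain ⟨R₂, hR₂⟩ : ∃ R₂, ∀ R, R₂ ≤ R → 4 * C ^ 2 * T R ≤ ε / 8 := by
    have h := (hTlim.const_mul (4 * C ^ 2))
    rw [mul_zero] at h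
    obtain ⟨R₂, h⟩ := (h.eventually (ge_mem_nhds (by positivity : (0:ℝ) < ε / 8)))
      |>.exists_forall_of_atTop
    exact ⟨R₂, h⟩
  set R₃ : ℝ := 8 * C ^ 2 * h k ^ 2 / (ε / 4) with hR₃
  refine ⟨max (max (2 * k) R₁) (max R₂ (R₃ + 1)), ?_, fun R hR => ?_⟩
  · exact le_trans (by linarith) ((le_max_left _ _).trans (le_max_left _ _))
  have hR2k : 2 * k ≤ R := ((le_max_left _ _).trans (le_max_left _ _)).trans hR
  have hRR₁ : R₁ ≤ R := ((le_max_right _ _).trans (le_max_left _ _)).trans hR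
  have hRR₂ : R₂ ≤ R := ((le_max_left _ _).trans (le_max_right _ _)).trans hR
  have hRR₃ : R₃ + 1 ≤ R := ((le_max_right _ _).trans (le_max_right _ _)).trans hR
  have hR1 : 1 ≤ R := by linarith
  have hR0 : 0 < R := by linarith
  -- the cut-off factor `θ(x) = 1 − χ(x/R)` and its derivative
  set θ : ℝ → ℝ := fun x => 1 - χ (x / R) with hθ
  have hθd : ∀ x, HasDerivAt θ (-(deriv χ (x / R) / R)) x := by
    intro x
    have h1 : HasDerivAt (fun y => χ (y / R)) (deriv χ (x / R) * (1 / R)) x :=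
      (hχd (x / R)).comp x ((hasDerivAt_id x).div_const R)
    have h2 := (hasDerivAt_const x (1 : ℝ)).sub h1
    exact h2.congr_deriv (by ring)
  have hθ01 : ∀ x, 0 ≤ θ x ∧ θ x ≤ 1 := fun x => by
    have := hχ01 (x / R); simp only [hθ]; constructor <;> linarith [this.1, this.2]
  have hθ0 : ∀ x, x ≤ R → θ x = 0 := fun x hx => by
    simp only [hθ, hχ1 (x / R) ((div_le_one hR0).2 hx), sub_self]
  have hθ1 : ∀ x, 2 * R ≤ x → θ x = 1 := fun x hx => by
    simp only [hθ, hχ2 (x / R) ((le_div_iff₀ hR0).2 (by linarith)), sub_zero]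
  have hθ'b : ∀ x, |deriv χ (x / R) / R| ≤ C / R := fun x => by
    rw [abs_div, abs_of_pos hR0]; exact div_le_div_of_nonneg_right (hC _) hR0.le
  have hθ'0 : ∀ x, x < R → deriv χ (x / R) = 0 := by
    intro x hx
    have hev : χ =ᶠ[𝓝 (x / R)] fun _ => 1 :=
      Filter.mem_of_superset (Iio_mem_nhds ((div_lt_one hR0).2 hx)) fun y hy =>
        hχ1 y (le_of_lt hy)
    rw [hev.deriv_eq, deriv_const]
  -- the integrand and its pointwise bound
  set I : ℝ → ℝ := fun x => deriv (fun y => θ y * h y) x ^ 2 + W x * (θ x * h x) ^ 2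
    + (θ x * g x) ^ 2 with hI
  have hIder : ∀ x, deriv (fun y => θ y * h y) x = -(deriv χ (x / R) / R) * h x + θ x * deriv h x :=
    fun x => ((hθd x).mul (hd x)).deriv
  have hIcont : Continuous I := by
    have hθc : Continuous θ :=
      continuous_const.sub (hχC.continuous.comp (continuous_id.div_const R))
    have hdθh : Continuous fun x => deriv (fun y => θ y * h y) x := by
      simp only [hIder]
      exact (((hχC.continuous_deriv (by simp)).comp (continuous_id.div_const R)).div_const R
        |>.neg.mul hhc).add (hθc.mul hdc)
    simp only [hI]
    exact ((hdθh.pow 2).add (hW.mul ((hθc.mul hhc).pow 2))).add ((hθc.mul hg).pow 2)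
  have hIzero : ∀ x, x < R → I x = 0 := by
    intro x hx
    simp only [hI, hIder, hθ0 x hx.le, hθ'0 x hx]; ring
  have hIfar : ∀ x, 2 * R < x → I x = deriv h x ^ 2 + W x * h x ^ 2 + g x ^ 2 := by
    intro x hx
    have hθ'x : deriv χ (x / R) = 0 := by
      have hev : χ =ᶠ[𝓝 (x / R)] fun _ => 0 :=
        Filter.mem_of_superset (Ioi_mem_nhds ((lt_div_iff₀ hR0).2 (by linarith))) fun y hy =>
          hχ2 y (le_of_lt hy)
      rw [hev.deriv_eq, deriv_const]
    simp only [hI, hIder, hθ1 x hx.le, hθ'x]; ring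
  have hIbd : ∀ x, R ≤ x → I x ≤ f x + 2 * (C / R) ^ 2 * h x ^ 2 := by
    intro x _
    have ha : |-(deriv χ (x / R) / R)| ≤ C / R := by rw [abs_neg]; exact hθ'b x
    have hθx := hθ01 x
    have key := cutoff_density_le (h := h x) (h' := deriv h x) (g := g x) ha hθx.1 hθx.2 (hW0 x)
    simp only [hI, hf, hIder]
    exact key
  -- integrability on `Ioi 1`
  have hInt : IntegrableOn I (Ioi 1) := by
    have h1 : IntegrableOn I (Ioc 1 (2 * R)) :=
      (hIcont.continuousOn.integrableOn_Icc).mono_set Ioc_subset_Icc_self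
    have h2 : IntegrableOn I (Ioi (2 * R)) := by
      refine IntegrableOn.congr_fun (f := fun x => deriv h x ^ 2 + W x * h x ^ 2 + g x ^ 2) ?_
        (fun x hx => (hIfar x hx).symm) measurableSet_Ioi
      exact ((hE1.add hE2).add hE3).mono_set (Ioi_subset_Ioi (by linarith))
    have hu : Ioi (1 : ℝ) = Ioc 1 (2 * R) ∪ Ioi (2 * R) := (Ioc_union_Ioi_eq_Ioi (by linarith)).symm
    rw [hu]; exact h1.union h2
  refine ⟨hInt, ?_⟩
  -- the estimate
  have hsplit : (∫ x in Ioi 1, I x) = ∫ x in Ioi R, I x := by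
    rw [← Ioc_union_Ioi_eq_Ioi hR1, setIntegral_union (Ioc_disjoint_Ioi le_rfl) measurableSet_Ioi
      (hInt.mono_set Ioc_subset_Ioi_self) (hInt.mono_set (Ioi_subset_Ioi hR1))]
    have : (∫ x in Ioc 1 R, I x) = 0 := by
      rw [← intervalIntegral.integral_of_le hR1]
      refine intervalIntegral.integral_zero_ae (Filter.Eventually.of_forall fun x hx => ?_)
      rw [uIoc_of_le hR1] at hx
      rcases eq_or_lt_of_le hx.2 with h | h
      · -- at `x = R` the integrand vanishes too
        simp only [hI, hIder, h, hθ0 R le_rfl]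
        have : deriv χ (R / R) = 0 := by
          have hc : ContinuousAt (deriv χ) 1 := (hχC.continuous_deriv (by simp)).continuousAt
          have hzero : ∀ y, y < (1 : ℝ) → deriv χ y = 0 := fun y hy => by
            have hev : χ =ᶠ[𝓝 y] fun _ => 1 :=
              Filter.mem_of_superset (Iio_mem_nhds hy) fun z hz => hχ1 z (le_of_lt hz)
            rw [hev.deriv_eq, deriv_const]
          rw [div_self hR0.ne']
          have hlim : Tendsto (deriv χ) (𝓝[<] 1) (𝓝 (deriv χ 1)) := hc.tendsto.mono_left
            nhdsWithin_le_nhds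
          have hlim0 : Tendsto (deriv χ) (𝓝[<] 1) (𝓝 0) :=
            tendsto_const_nhds.congr'
              (eventually_nhdsWithin_of_forall fun y hy => (hzero y hy).symm)
          exact tendsto_nhds_unique hlim hlim0
        rw [this]; ring
      · exact hIzero x h
    rw [this, zero_add]
  have hJint : IntegrableOn (fun x => f x + 2 * (C / R) ^ 2 * h x ^ 2) (Ioc R (2 * R)) :=
    ((((hdc.pow 2).const_mul 2).add (hW.mul (hhc.pow 2))).add (hg.pow 2)).add
      ((hhc.pow 2).const_mul _) |>.continuousOn.integrableOn_Icc.mono_set Ioc_subset_Icc_self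
  have hpart1 : (∫ x in Ioc R (2 * R), I x)
      ≤ ∫ x in Ioc R (2 * R), (f x + 2 * (C / R) ^ 2 * h x ^ 2) :=
    setIntegral_mono_on (hInt.mono_set (Ioc_subset_Ioi_self.trans (Ioi_subset_Ioi hR1))) hJint
      measurableSet_Ioc fun x hx => hIbd x hx.1.le
  have hpart2 : (∫ x in Ioi (2 * R), I x) ≤ τ (2 * R) := by
    refine setIntegral_mono_on (hInt.mono_set (Ioi_subset_Ioi (by linarith)))
      (hfi.mono_set (Ioi_subset_Ioi (by linarith))) measurableSet_Ioi fun x hx => ?_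
    have := hIbd x (le_of_lt (lt_trans (by linarith) hx))
    rw [hIfar x hx]; simp only [hf]; nlinarith [sq_nonneg (deriv h x)]
  have hτmono : τ (2 * R) ≤ τ R := setIntegral_mono_set (hfi.mono_set (Ioi_subset_Ioi hR1))
    (ae_of_all _ hf0) (ae_of_all _ (Ioi_subset_Ioi (by linarith)))
  have hh2 : (∫ x in Ioc R (2 * R), h x ^ 2) ≤ R * (2 * h R ^ 2 + 2 * R * T R) := by
    have hb : ∀ x ∈ Ioc R (2 * R), h x ^ 2 ≤ 2 * h R ^ 2 + 2 * R * T R := by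
      intro x hx
      have := hgrow R x hR1 hx.1.le
      nlinarith [hT0 R, hx.2]
    calc (∫ x in Ioc R (2 * R), h x ^ 2) ≤ ∫ x in Ioc R (2 * R), (2 * h R ^ 2 + 2 * R * T R) :=
          setIntegral_mono_on ((hhc.pow 2).continuousOn.integrableOn_Icc.mono_set
            Ioc_subset_Icc_self) (continuous_const.continuousOn.integrableOn_Icc.mono_set
            Ioc_subset_Icc_self) measurableSet_Ioc hb
      _ = R * (2 * h R ^ 2 + 2 * R * T R) := by
          rw [setIntegral_const]
          simp only [smul_eq_mul, Real.volume_real_Ioc_of_le (by linarith : R ≤ 2 * R)]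
          ring
  have hτf : (∫ x in Ioc R (2 * R), f x) ≤ τ R :=
    setIntegral_mono_set (hfi.mono_set (Ioi_subset_Ioi hR1)) (ae_of_all _ hf0)
      (ae_of_all _ Ioc_subset_Ioi_self)
  have hgrowR : h R ^ 2 ≤ 2 * h k ^ 2 + 2 * (R - k) * T k := hgrow k R hk1 (by linarith)
  -- assemble
  have hC2R : 0 ≤ (C / R) ^ 2 := sq_nonneg _
  calc (∫ x in Ioi 1, I x) = ∫ x in Ioi R, I x := hsplit
    _ = (∫ x in Ioc R (2 * R), I x) + ∫ x in Ioi (2 * R), I x := by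
        rw [← Ioc_union_Ioi_eq_Ioi (by linarith : R ≤ 2 * R), setIntegral_union
          (Ioc_disjoint_Ioi le_rfl) measurableSet_Ioi
          (hInt.mono_set (Ioc_subset_Ioi_self.trans (Ioi_subset_Ioi hR1)))
          (hInt.mono_set (Ioi_subset_Ioi (by linarith)))]
    _ ≤ (∫ x in Ioc R (2 * R), (f x + 2 * (C / R) ^ 2 * h x ^ 2)) + τ (2 * R) :=
        add_le_add hpart1 hpart2
    _ = (∫ x in Ioc R (2 * R), f x) + 2 * (C / R) ^ 2 * (∫ x in Ioc R (2 * R), h x ^ 2)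
          + τ (2 * R) := by
        have i1 : IntegrableOn (fun x => f x) (Ioc R (2 * R)) :=
          hfi.mono_set (Ioc_subset_Ioi_self.trans (Ioi_subset_Ioi hR1))
        have i2 : IntegrableOn (fun x => 2 * (C / R) ^ 2 * h x ^ 2) (Ioc R (2 * R)) :=
          ((hhc.pow 2).const_mul _).continuousOn.integrableOn_Icc.mono_set Ioc_subset_Icc_self
        rw [integral_add i1 i2, MeasureTheory.integral_const_mul]
    _ ≤ τ R + 2 * (C / R) ^ 2 * (R * (2 * h R ^ 2 + 2 * R * T R)) + τ R := by
        gcongr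
    _ ≤ ε := by
        have e1 : τ R ≤ ε / 8 := hR₁ R hRR₁
        have e2 : 4 * C ^ 2 * T R ≤ ε / 8 := hR₂ R hRR₂
        have e3 : 2 * (C / R) ^ 2 * (R * (2 * h R ^ 2 + 2 * R * T R))
            = 4 * C ^ 2 * (h R ^ 2 / R) + 4 * C ^ 2 * T R := by
          field_simp
          ring
        have e4 : h R ^ 2 / R ≤ 2 * h k ^ 2 / R + 2 * T k := by
          have hkT : 0 ≤ k * T k := mul_nonneg (by linarith) (hT0 k)
          have e : 2 * (R - k) * T k = 2 * (R * T k) - 2 * (k * T k) := by ring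
          have h1 : h R ^ 2 ≤ 2 * h k ^ 2 + 2 * R * T k := by linarith [hgrowR, hkT, e]
          calc h R ^ 2 / R ≤ (2 * h k ^ 2 + 2 * R * T k) / R :=
                div_le_div_of_nonneg_right h1 hR0.le
            _ = 2 * h k ^ 2 / R + 2 * T k := by field_simp
        have e5 : 8 * C ^ 2 * (h k ^ 2 / R) ≤ ε / 4 := by
          have hR₃R : R₃ ≤ R := by linarith
          have hR₃0 : 0 ≤ R₃ := by rw [hR₃]; positivity
          have key : 8 * C ^ 2 * (h k ^ 2 / R) = (ε / 4) * (R₃ / R) := by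
            rw [hR₃]; field_simp
          rw [key]
          have : R₃ / R ≤ 1 := (div_le_one hR0).2 hR₃R
          calc (ε / 4) * (R₃ / R) ≤ (ε / 4) * 1 :=
                mul_le_mul_of_nonneg_left this (by positivity)
            _ = ε / 4 := mul_one _
        rw [e3]
        clear_value I θ T τ f R₃
        have e4' : 4 * C ^ 2 * (h R ^ 2 / R) ≤ 8 * C ^ 2 * (h k ^ 2 / R) + 8 * C ^ 2 * T k := by
          have h4 := mul_le_mul_of_nonneg_left e4 (by positivity : (0 : ℝ) ≤ 4 * C ^ 2)
          have e : 4 * C ^ 2 * (2 * h k ^ 2 / R + 2 * T k)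
              = 8 * C ^ 2 * (h k ^ 2 / R) + 8 * C ^ 2 * T k := by ring
          linarith [h4, e]
        linarith [e1, e2, e4', e5, hk, hτmono]

end Literature.Analysis.Calculus
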